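import Summits.KontsevichZagierPeriods.KontsevichZagierPeriods.Theorems.RootDecompWalshStrataConicStrata
import Summits.KontsevichZagierPeriods.KontsevichZagierPeriods.Theorems.RootDecompWalshStrataScaledLW02

/-!
# Root decomposition & Walsh strata — the conic-wall terminal, part 4: the constant-radicand stratum (gen 8, §36.8)

Route `RootDecompWalshStrata`, leaf `QuadricBakerDescent` (stmt-27597), residual R-E2 (NODE.md, decomp-kz-lens-4).
The last degenerate stratum of the conic-wall height terminal: `δe = δf = 0`, i.e. the radicand
`δ` of the branch `X = (l₁L + ε√δ)/k` is the CONSTANT `δg =: m > 0`, so `√δ = √m` is an irrational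
constant.  Two sub-cases (`δf = 2aκ₀l₀l₂ = 0`): (i) `l₂ = 0` — then `L, P, δ, Λ` and the whole
integrand are constant; `ConicWall.terminal_identity` + `InBaker.peel_rat` leave the scaled constant
`(N₁(0)/(mR₄(0)))·√m` (`InBaker.sqrt_const`); (ii) `l₀ = 0`, `l₂ ≠ 0` — then `k, κ₁ > 0 > c`,
`Λ = (aκ₀l₂Y + l₁√m)/k` is AFFINE in `Y` with an irrational offset, and the single `ℚ`-semialgebraic
chart `Y ↦ s = Λ(Y)/λ` (`λ ∈ ℚ` large) turns the integrand into `C·s³/((−c) + λ²s²)·√m` on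
`|s| ≤ 1`: the landed scaled class `InBaker.sqrt_const_div_W` (after a split at `s = 0` and a
reflection).  Packaged, with the sign splitter and both branches, as `InBaker.conic_height_const`.
[KontsevichZagier2001 §1.2; this node]
-/

noncomputable section

open Set MeasureTheory Literature.NumberTheory.Transcendental
open Literature.ModelTheory.ExponentialFields (IsSemialgebraic isSemialgebraic_univ
  isSemialgebraic_setOf_eval_pos)

namespace Summit.KontsevichZagierPeriods.RootDecompWalshStrata.ConicDescent

/-! #### 36.8 The constant-radicand stratum -/

namespace ConicWall

variable (W : ConicWall)

/-- Auxiliary step `δ_const`. [bookkeeping] -/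
theorem δ_const (he : W.δe = 0) (hf : W.δf = 0) (y : ℝ) : W.δ y = W.δg := by
  rw [W.δ_eq_qD, he, hf]; simp [qD]

/-- Auxiliary step `P_const`. [bookkeeping] -/
theorem P_const (hl₂ : W.l₂ = 0) (y : ℝ) : W.P y = W.a * W.κ₀ * W.l₀ := by
  simp [ConicWall.P, ConicWall.L, hl₂]

/-- Auxiliary step `P_lin`. [bookkeeping] -/
theorem P_lin (hl₀ : W.l₀ = 0) (y : ℝ) : W.P y = W.a * W.κ₀ * W.l₂ * y := by
  simp only [ConicWall.P, ConicWall.L, hl₀]; push_cast; ring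

/-- `l₂ = 0`, `δ` constant: `N₁` is a constant polynomial (as a function). -/
theorem aeval_N₁Y_const (γ s : ℚ) (hl₂ : W.l₂ = 0) (he : W.δe = 0) (hf : W.δf = 0) (y : ℝ) :
    Polynomial.aeval y (W.N₁Y γ s) = (((W.N₁Y γ s).coeff 0 : ℚ) : ℝ) := by
  have h0 : (((W.N₁Y γ s).coeff 0 : ℚ) : ℝ) = Polynomial.aeval (0 : ℝ) (W.N₁Y γ s) := by
    rw [← Polynomial.coeff_zero_eq_aeval_zero', eq_ratCast]
  rw [h0]
  simp only [N₁Y, A₁Y, A₂Y, R4Y, map_add, map_sub, map_mul, map_pow, Polynomial.aeval_C,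
    aeval_PY, aeval_δY]
  rw [W.P_const hl₂ y, W.P_const hl₂ 0, W.δ_const he hf y, W.δ_const he hf 0]

/-- `l₂ = 0`, `δ` constant: `R₄` is a constant polynomial (as a function). -/
theorem aeval_R4Y_const (hl₂ : W.l₂ = 0) (he : W.δe = 0) (hf : W.δf = 0) (y : ℝ) :
    Polynomial.aeval y W.R4Y = ((W.R4Y.coeff 0 : ℚ) : ℝ) := by
  have h0 : ((W.R4Y.coeff 0 : ℚ) : ℝ) = Polynomial.aeval (0 : ℝ) W.R4Y := by
    rw [← Polynomial.coeff_zero_eq_aeval_zero', eq_ratCast]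
  rw [h0]
  simp only [R4Y, map_add, map_sub, map_mul, map_pow, Polynomial.aeval_C, aeval_PY, aeval_δY]
  rw [W.P_const hl₂ y, W.P_const hl₂ 0, W.δ_const he hf y, W.δ_const he hf 0]

end ConicWall

/-- Auxiliary step `const₁_identity`. [bookkeeping] -/
private theorem const₁_identity (γ s c lam K t u : ℝ) (hu : u ≠ 0)
    (hD : -c + lam ^ 2 * t ^ 2 ≠ 0) :
    -(γ * s * c * lam ^ 3 * K) / (3 * u ^ 2) * t ^ 3 / (-c + lam ^ 2 * t ^ 2) * u =
      γ * s / 3 * (lam * t) ^ 3 * (0 * (lam * t) - c) / (u * ((lam * t) ^ 2 - c)) * K := by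
  have hD' : (lam * t) ^ 2 - c = -c + lam ^ 2 * t ^ 2 := by ring
  rw [hD']
  field_simp
  ring

/-- `posHalfLine` is `ℚ`-semialgebraic. [BCR1998 §2.2] -/
private theorem isSemialgebraic_posHalfLine' : IsSemialgebraic ℚ {v : Fin 1 → ℝ | 0 < v 0} := by
  simpa using isSemialgebraic_setOf_eval_pos (k := ℚ) (R := ℝ)
    (MvPolynomial.X 0 : MvPolynomial (Fin 1) ℚ)

/-- **SIGNED CONIC TERMINAL, constant radicand, `l₂ = 0`:** everything is constant; peel `M/R₄`
and the rest is the scaled constant `(N₁/(mR₄))·√m`. [this node] -/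
theorem InBaker.conic_terminal_signed_const₀ (W : ConicWall) (γ s : ℚ) (hk : W.k ≠ 0)
    (hl₂ : W.l₂ = 0) (he : W.δe = 0) (lo hi : ℚ)
    (hR4 : ∀ x : ℝ, (lo : ℝ) ≤ x → x ≤ hi → Polynomial.aeval x W.R4Y ≠ 0)
    (r : KZ.IntegralRep 1) (hdom : ∀ v ∈ r.domain, (lo : ℝ) ≤ v 0 ∧ v 0 ≤ hi)
    (hδ : ∀ v ∈ r.domain, 0 < W.δ (v 0))
    (hr : EqOn r.integrand (fun v => (γ * s / 3 : ℝ) * W.Λ (v 0) ^ 3 *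
      (W.l₀ * W.Λ (v 0) - W.c) / (√(W.δ (v 0)) * (W.Λ (v 0) ^ 2 - W.c))) r.domain) :
    InBaker (KZ.of r) := by
  have hf : W.δf = 0 := by simp [ConicWall.δf, hl₂]
  refine InBaker.peel_rat (W.MY γ s) W.R4Y lo hi hR4 r hdom
    (fun v => Polynomial.aeval (v 0) (W.N₁Y γ s) / Polynomial.aeval (v 0) W.R4Y /
      √(qD W.δe W.δf W.δg (v 0))) (fun v hv => ?_) fun rB hBd hBi => ?_
  · rw [hr hv]
    beta_reduce
    rw [W.terminal_identity γ s hk (v 0) (hδ v hv) (hR4 _ (hdom v hv).1 (hdom v hv).2)]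
    ring
  · rcases rB.domain.eq_empty_or_nonempty with h0 | ⟨v₀, hv₀⟩
    · exact InBaker.of_domain_eq_empty rB h0
    have hv₀' : v₀ ∈ r.domain := by rwa [hBd] at hv₀
    have hm : 0 < W.δg := by
      have h := hδ v₀ hv₀'
      rw [W.δ_const he hf] at h
      exact_mod_cast h
    have hρ : ((W.R4Y.coeff 0 : ℚ) : ℝ) ≠ 0 := by
      rw [← W.aeval_R4Y_const hl₂ he hf (v₀ 0)]
      exact hR4 _ (hdom v₀ hv₀').1 (hdom v₀ hv₀').2
    refine InBaker.sqrt_const W.δg ((W.N₁Y γ s).coeff 0 / (W.R4Y.coeff 0 * W.δg)) hm rB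
      fun v hv => ?_
    rw [hBi hv]
    beta_reduce
    rw [W.aeval_N₁Y_const γ s hl₂ he hf, W.aeval_R4Y_const hl₂ he hf, he, hf]
    have hq : qD 0 0 W.δg (v 0) = W.δg := by simp [qD]
    have hm' : (0 : ℝ) < W.δg := by exact_mod_cast hm
    obtain ⟨t, ht⟩ : ∃ t : ℝ, t = √(qD 0 0 W.δg (v 0)) := ⟨_, rfl⟩
    have ht0 : t ≠ 0 := by rw [ht, hq]; exact (Real.sqrt_pos.2 hm').ne'
    have htt : t ^ 2 = W.δg := by rw [ht, hq, Real.sq_sqrt hm'.le]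
    rw [← ht]
    push_cast
    rw [← htt]
    field_simp

/-- **SIGNED CONIC TERMINAL, constant radicand, `l₀ = 0 ≠ l₂`:** `Λ` is affine in `Y`; the chart
`s = Λ(Y)/λ` makes the integrand `C·s³/((−c) + λ²s²)·√m` on `|s| ≤ 1` — `InBaker.sqrt_const_div_W`
on `s > 0` and, reflected, on `s < 0`. [this node] -/
theorem InBaker.conic_terminal_signed_const₁ (W : ConicWall) (γ s : ℚ) (hk : W.k ≠ 0)
    (ha : W.a ≠ 0) (hκ₀ : W.κ₀ ≠ 0) (hl₀ : W.l₀ = 0) (hl₂ : W.l₂ ≠ 0) (hc : W.c < 0)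
    (he : W.δe = 0) (lo hi : ℚ)
    (r : KZ.IntegralRep 1) (hdom : ∀ v ∈ r.domain, (lo : ℝ) ≤ v 0 ∧ v 0 ≤ hi)
    (hδ : ∀ v ∈ r.domain, 0 < W.δ (v 0))
    (hr : EqOn r.integrand (fun v => (γ * s / 3 : ℝ) * W.Λ (v 0) ^ 3 *
      (W.l₀ * W.Λ (v 0) - W.c) / (√(W.δ (v 0)) * (W.Λ (v 0) ^ 2 - W.c))) r.domain) :
    InBaker (KZ.of r) := by
  have hf : W.δf = 0 := by simp [ConicWall.δf, hl₀]
  rcases r.domain.eq_empty_or_nonempty with h0 | ⟨v₀, hv₀⟩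
  · exact InBaker.of_domain_eq_empty r h0
  -- the constant radicand `m = δg > 0`, `u = √m`
  obtain ⟨m, hmdef⟩ : ∃ m : ℚ, m = W.δg := ⟨_, rfl⟩
  have hδm : ∀ y, W.δ y = m := fun y => by rw [W.δ_const he hf, hmdef]
  have hm : 0 < m := by have h := hδ v₀ hv₀; rw [hδm] at h; exact_mod_cast h
  have hm' : (0 : ℝ) < m := by exact_mod_cast hm
  set u := √(m : ℝ) with hu_def
  have hu0 : 0 < u := Real.sqrt_pos.2 hm'
  have huu : u ^ 2 = m := Real.sq_sqrt hm'.le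
  -- the slope `α = aκ₀l₂ ≠ 0` of `P`, and `Λ = (αY + l₁u)/k`
  obtain ⟨α, hαdef⟩ : ∃ α : ℚ, α = W.a * W.κ₀ * W.l₂ := ⟨_, rfl⟩
  have hα : α ≠ 0 := by rw [hαdef]; exact mul_ne_zero (mul_ne_zero ha hκ₀) hl₂
  have hα' : (α : ℝ) ≠ 0 := by exact_mod_cast hα
  have hk' : (W.k : ℝ) ≠ 0 := by exact_mod_cast hk
  have hP : ∀ y, W.P y = α * y := fun y => by rw [W.P_lin hl₀, hαdef]; push_cast; ring
  have hΛ : ∀ y, W.Λ y = (α * y + W.l₁ * u) / W.k := fun y => by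
    simp only [ConicWall.Λ, hP, hδm, hu_def]
  -- a rational scale `lam > |Λ|` on the hull
  obtain ⟨B, hBdef⟩ : ∃ B : ℝ, B = (|(α : ℝ)| * max |(lo : ℝ)| |(hi : ℝ)| + |(W.l₁ : ℝ)| * u) /
    |(W.k : ℝ)| := ⟨_, rfl⟩
  have hΛB : ∀ y : ℝ, (lo : ℝ) ≤ y → y ≤ hi → |W.Λ y| ≤ B := fun y h₁ h₂ => by
    rw [hΛ, hBdef, abs_div]
    refine div_le_div_of_nonneg_right ((abs_add_le _ _).trans (add_le_add ?_ ?_)) (abs_nonneg _)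
    · rw [abs_mul]
      exact mul_le_mul_of_nonneg_left (abs_le_max_abs_abs h₁ h₂) (abs_nonneg _)
    · rw [abs_mul, abs_of_pos hu0]
  obtain ⟨lam, hlam⟩ := exists_rat_gt (max B 1)
  have hlam1 : (1 : ℝ) < lam := (le_max_right _ _).trans_lt hlam
  have hlamB : B < lam := (le_max_left _ _).trans_lt hlam
  have hlam0 : (0 : ℝ) < lam := one_pos.trans hlam1
  have hlam0' : (lam : ℝ) ≠ 0 := hlam0.ne'
  have hlamq : lam ≠ 0 := by exact_mod_cast hlam0'
  -- the chart `Y = g(s) = (klams − l₁u)/α`, inverse to `s = Λ(Y)/lam`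
  obtain ⟨g, hgdef⟩ : ∃ g : ℝ → ℝ, g = fun t => ((W.k : ℝ) * lam * t - W.l₁ * u) / α := ⟨_, rfl⟩
  have hΛg : ∀ t, W.Λ (g t) = lam * t := fun t => by
    rw [hΛ, hgdef]
    field_simp
    ring
  have hgΛ : ∀ y, g (W.Λ y / lam) = y := fun y => by
    rw [hgdef, hΛ]
    beta_reduce
    field_simp
    ring
  have hbound : ∀ t : ℝ, g t ∈ (fun v : Fin 1 → ℝ => v 0) '' r.domain → |t| ≤ 1 := by
    rintro t ⟨x, hx, hxt⟩
    have hx0 : x 0 = g t := hxt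
    have h1 : t = W.Λ (x 0) / lam := by
      rw [hx0, hΛg]; field_simp
    have h2 := (hΛB (x 0) (hdom x hx).1 (hdom x hx).2).trans hlamB.le
    rw [h1, abs_div, abs_of_pos hlam0]
    exact (div_le_one hlam0).2 h2
  -- the constant `C` of the pulled-back integrand `C·s³/((−c) + lam²s²)·√m`
  obtain ⟨C, hCdef⟩ : ∃ C : ℚ, C = -(γ * s * W.c * lam ^ 3 * |W.k * lam / α|) / (3 * m) := ⟨_, rfl⟩
  obtain ⟨Dp, hDp⟩ : ∃ Dp : Polynomial ℚ,
      Dp = Polynomial.C (-W.c) + Polynomial.C (lam ^ 2) * Polynomial.X ^ 2 := ⟨_, rfl⟩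
  have hDx : ∀ x : ℝ, Polynomial.aeval x Dp = -(W.c : ℝ) + (lam : ℝ) ^ 2 * x ^ 2 := fun x => by
    rw [hDp]
    simp only [map_add, map_mul, map_pow, Polynomial.aeval_C, Polynomial.aeval_X, eq_ratCast]
    push_cast
    ring
  have hc' : (W.c : ℝ) < 0 := by exact_mod_cast hc
  have hDpos : ∀ x : ℝ, 0 < -(W.c : ℝ) + (lam : ℝ) ^ 2 * x ^ 2 := fun x =>
    add_pos_of_pos_of_nonneg (neg_pos.2 hc') (by positivity)
  have hD0 : ∀ x : ℝ, Polynomial.aeval x Dp ≠ 0 := fun x => by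
    rw [hDx]; exact (hDpos x).ne'
  have hqD : ∀ x : ℝ, qD 0 0 m x = m := fun x => by simp [qD]
  obtain ⟨R, hRdef⟩ : ∃ R : ℚ → (Fin 1 → ℝ) → ℝ, R = fun C' v =>
      Polynomial.aeval (v 0) (Polynomial.C C' * Polynomial.X ^ 3) / Polynomial.aeval (v 0) Dp *
        √(qD 0 0 m (v 0)) := ⟨_, rfl⟩
  have hRx : ∀ C' : ℚ, ∀ v : Fin 1 → ℝ,
      R C' v = (C' : ℝ) * v 0 ^ 3 / (-(W.c : ℝ) + (lam : ℝ) ^ 2 * v 0 ^ 2) * u := fun C' v => by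
    rw [hRdef]
    beta_reduce
    rw [hDx, hqD, ← hu_def]
    simp only [map_mul, map_pow, Polynomial.aeval_C, Polynomial.aeval_X, eq_ratCast]
  have hRsa : ∀ C' : ℚ, ∀ {T : Set (Fin 1 → ℝ)}, IsSemialgebraic ℚ T →
      IsSemialgebraicFunOn ℚ T (R C') := fun C' T hT => by
    rw [hRdef]
    exact ((((IsRatOn.polyAeval (Polynomial.C C' * Polynomial.X ^ 3) IsRatOn.coord).div
      (IsRatOn.polyAeval Dp IsRatOn.coord) fun v _ => hD0 (v 0)).isSemialgebraicFunOn hT).mul_holds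
      (IsSemialgebraicFunOn.sqrt_holds (isSemialgebraicFunOn_qD 0 0 m hT))).congr fun v _ => by
      simp only [Pi.mul_apply]
  -- the terminal on `0 ≤ s ≤ 1`
  have hterm : ∀ C' : ℚ, ∀ r₃ : KZ.IntegralRep 1, (∀ v ∈ r₃.domain, 0 ≤ v 0 ∧ v 0 ≤ 1) →
      r₃.integrand = R C' → InBaker (KZ.of r₃) := fun C' r₃ hI hi => by
    refine InBaker.sqrt_const_div_W m hm (-W.c) (lam ^ 2) (neg_pos.2 hc) (sq_nonneg _)
      (Polynomial.C C' * Polynomial.X ^ 3) r₃ hI fun v _ => ?_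
    rw [hi, hRdef, hDp]
  -- the chart
  have hgsa : IsSemialgebraicFunOn ℚ (univ : Set (Fin 1 → ℝ)) fun v => g (v 0) := by
    have hU : IsSemialgebraic ℚ (univ : Set (Fin 1 → ℝ)) := isSemialgebraic_univ
    rw [hgdef]
    exact (((isSemialgebraicFunOn_ratCast hU (W.k * lam / α)).mul_holds
      (isSemialgebraicFunOn_apply hU 0)).sub_holds
      ((isSemialgebraicFunOn_ratCast hU (W.l₁ / α)).mul_holds
        (IsSemialgebraicFunOn.sqrt_holds (isSemialgebraicFunOn_ratCast hU m)))).congr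
      fun v _ => by
        simp only [Pi.mul_apply, Pi.sub_apply, hu_def]
        push_cast
        field_simp
  refine InBaker.of_cov₁' r isSemialgebraic_univ g (fun _ => (W.k : ℝ) * lam / α) hgsa
    (fun v _ => ?_) (fun a _ b _ hab => ?_) (fun x hx => ⟨fun _ => W.Λ (x 0) / lam, mem_univ _, hgΛ _⟩)
    (R C) (hRsa C isSemialgebraic_univ) (fun v _ hvd => ?_) fun r₁ hd₁ hi₁ => ?_
  · -- derivative
    rw [hgdef]
    have h := (((hasDerivAt_id (v 0)).const_mul ((W.k : ℝ) * lam)).sub_const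
      ((W.l₁ : ℝ) * u)).div_const (α : ℝ)
    simpa using h
  · -- injective
    rw [hgdef] at hab
    have h : (W.k : ℝ) * lam * a 0 = (W.k : ℝ) * lam * b 0 := by
      have := (div_left_inj' hα').1 hab
      linarith
    exact mul_left_cancel₀ (mul_ne_zero hk' hlam0') h
  · -- the pulled-back integrand
    have hvd' : lift₁ g v ∈ r.domain := hvd
    rw [hr hvd', hRx]
    simp only [lift₁_apply]
    rw [hΛg, hδm, hl₀, hCdef]
    have hD : -(W.c : ℝ) + (lam : ℝ) ^ 2 * v 0 ^ 2 ≠ 0 := (hDpos _).ne'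
    have hD'' : -(W.c : ℝ) + v 0 ^ 2 * (lam : ℝ) ^ 2 ≠ 0 := by rw [mul_comm]; exact hD
    have hD' : ((lam : ℝ) * v 0) ^ 2 - W.c ≠ 0 := by
      rw [show ((lam : ℝ) * v 0) ^ 2 - W.c = -(W.c : ℝ) + (lam : ℝ) ^ 2 * v 0 ^ 2 by ring]
      exact (hDpos _).ne'
    rw [← hu_def]
    push_cast
    rw [← huu]
    linear_combination const₁_identity (γ : ℝ) s W.c lam |(W.k : ℝ) * lam / α| (v 0) u hu0.ne' hD
  · -- the pulled-back representation: split at `s = 0`, reflect the negative half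
    have hb₁ : ∀ v ∈ r₁.domain, |v 0| ≤ 1 := fun v hv => by
      rw [hd₁] at hv
      exact hbound (v 0) ⟨lift₁ g v, hv.2, rfl⟩
    refine InBaker.of_split_at 0 r₁ (fun r₂ hd₂ hi₂ => ?_) fun r₂ hd₂ hi₂ => ?_
    · refine hterm C r₂ (fun v hv => ?_) (by rw [hi₂, hi₁])
      rw [hd₂] at hv
      have h1 := hb₁ v hv.1
      have h2 : (0 : ℝ) < v 0 := by simpa using hv.2
      exact ⟨h2.le, (abs_le.1 h1).2⟩
    · have hT₀ := isSemialgebraic_posHalfLine'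
      refine InBaker.of_reflect' 0 r₂ hT₀ (fun x hx => ?_) (R (-C)) (hRsa (-C) hT₀)
        (fun v _ hvd => ?_) fun r₃ hd₃ hi₃ => hterm (-C) r₃ (fun v hv => ?_) hi₃
      · rw [hd₂] at hx
        have h2 : x 0 < 0 := by simpa using hx.2
        show (0 : ℝ) < ((0 : ℚ) : ℝ) - x 0
        push_cast
        linarith
      · rw [hi₂, hi₁, hRx, hRx]
        push_cast
        ring
      · rw [hd₃] at hv
        have h1 : (0 : ℝ) < v 0 := hv.1
        have h3 : (fun _ : Fin 1 => ((0 : ℚ) : ℝ) - v 0) ∈ r₁.domain := by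
          have h := hv.2
          rw [hd₂] at h
          exact h.1
        have h4 := hb₁ _ h3
        simp only [Rat.cast_zero, zero_sub, abs_neg] at h4
        exact ⟨h1.le, (abs_le.1 h4).2⟩

/-- **CONIC-WALL HEIGHT TERMINAL, constant radicand** (`δe = δf = 0`; both branches, both sub-cases).
[this node] -/
theorem InBaker.conic_height_const (W : ConicWall) (γ ε : ℚ) (hε : ε = 1 ∨ ε = -1) (hk : W.k ≠ 0)
    (ha : W.a ≠ 0) (hκ : 0 < W.κ₀ ∧ 0 ≤ W.κ₁) (he : W.δe = 0) (hf : W.δf = 0) (lo hi : ℚ)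
    (hR4 : ∀ x : ℝ, (lo : ℝ) ≤ x → x ≤ hi → Polynomial.aeval x W.R4Y ≠ 0)
    (r : KZ.IntegralRep 1) (hdom : ∀ v ∈ r.domain, (lo : ℝ) ≤ v 0 ∧ v 0 ≤ hi)
    (hδ : ∀ v ∈ r.domain, 0 < W.δ (v 0))
    (hr : EqOn r.integrand (BallCube.pheight W.κ₀ W.κ₁ γ W.a W.c (W.Xb ε) (W.Xb' ε)) r.domain) :
    InBaker (KZ.of r) := by
  have hSA := r.isSemialgebraic_domain
  rcases r.domain.eq_empty_or_nonempty with h0 | ⟨v₀, hv₀⟩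
  · exact InBaker.of_domain_eq_empty r h0
  have hκ' : 0 ≤ W.κ₀ ∧ 0 ≤ W.κ₁ := ⟨hκ.1.le, hκ.2⟩
  have hΛc : ∀ v ∈ r.domain,
      ((W.P (v 0) + ε * W.l₁ * √(W.δ (v 0))) / W.k) ^ 2 - W.c ≠ 0 := fun v hv =>
    W.Λε_sq_sub_ne ε hε hk (v 0) (hδ v hv).le (hR4 _ (hdom v hv).1 (hdom v hv).2)
  -- the sub-case: `l₂ = 0`, or `l₀ = 0 ≠ l₂` (and then `c < 0`)
  have hcase : W.l₂ = 0 ∨ (W.l₀ = 0 ∧ W.l₂ ≠ 0 ∧ W.c < 0) := by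
    by_cases hl₂ : W.l₂ = 0
    · exact Or.inl hl₂
    have hl₀ : W.l₀ = 0 := by
      have h : 2 * W.a * W.κ₀ * W.l₀ * W.l₂ = 0 := hf
      simpa [ha, hκ.1.ne', hl₂] using h
    refine Or.inr ⟨hl₀, hl₂, ?_⟩
    have h1 : W.k * W.κ₁ = W.κ₀ * W.l₂ ^ 2 := by
      have h : W.a * W.κ₀ * W.l₂ ^ 2 - W.k * (W.a * W.κ₁) = 0 := he
      exact mul_left_cancel₀ ha (by linear_combination -h)
    have h2 : 0 < W.κ₀ * W.l₂ ^ 2 := by have := hκ.1; positivity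
    have hkpos : 0 < W.k := by nlinarith [hκ.2]
    have h3 : 0 < W.δg := by
      have h := hδ v₀ hv₀
      rw [W.δ_const he hf] at h
      exact_mod_cast h
    have h4 : W.δg = -(W.k * W.c) := by simp [ConicWall.δg, hl₀]
    nlinarith
  -- the wall whose `+`-branch is our branch
  obtain ⟨W', hk', ha', hκ₀', he', hf', hl₂', hl₀', hR4', hδ', hl₀, hc, hΛ'⟩ : ∃ W' : ConicWall,
      W'.k ≠ 0 ∧ W'.a ≠ 0 ∧ W'.κ₀ ≠ 0 ∧ W'.δe = 0 ∧ W'.δf = 0 ∧ W'.l₂ = W.l₂ ∧ W'.l₀ = W.l₀ ∧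
      (∀ x : ℝ, (lo : ℝ) ≤ x → x ≤ hi → Polynomial.aeval x W'.R4Y ≠ 0) ∧
      (∀ y, W'.δ y = W.δ y) ∧ W'.l₀ = W.l₀ ∧ W'.c = W.c ∧
      ∀ y, W'.Λ y = (W.P y + ε * W.l₁ * √(W.δ y)) / W.k := by
    rcases hε with rfl | rfl
    · exact ⟨W, hk, ha, hκ.1.ne', he, hf, rfl, rfl, hR4, fun y => rfl, rfl, rfl, fun y => by
        simp only [ConicWall.Λ]; push_cast; ring⟩
    · exact ⟨W.negl₁, by rwa [W.negl₁_k], ha, hκ.1.ne', by rw [W.negl₁_δe, he],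
        by rw [W.negl₁_δf, hf], rfl, rfl,
        fun x h₁ h₂ => by rw [W.negl₁_R4Y]; exact hR4 x h₁ h₂, W.negl₁_δ, rfl, rfl, fun y => by
        rw [W.negl₁_Λ]; push_cast; ring⟩
  refine InBaker.abs_of_signed r
    (fun v => (γ / 3 : ℝ) / (√(W'.δ (v 0)) * (W'.Λ (v 0) ^ 2 - W'.c)))
    (fun v => W'.Λ (v 0) ^ 3 * (W'.l₀ * W'.Λ (v 0) - W'.c)) ?_ (fun v hv => ?_)
    fun s hs r' hsub hr' => ?_
  · have hΛ := W'.isSemialgebraicFunOn_Λ hSA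
    exact ((hΛ.mul_holds (hΛ.mul_holds hΛ)).mul_holds
      (((isSemialgebraicFunOn_ratCast hSA W'.l₀).mul_holds hΛ).sub_holds
        (isSemialgebraicFunOn_ratCast hSA W'.c))).congr fun v _ => by
      simp only [Pi.mul_apply, Pi.sub_apply]; ring
  · rw [hr hv]
    beta_reduce
    rw [W.pheight_Xb γ ε hε hk ha hκ' v (hδ v hv) (hΛc v hv), ← hΛ', hδ', hl₀, hc]
    ring
  · have hr'' : EqOn r'.integrand (fun v => (γ * s / 3 : ℝ) * W'.Λ (v 0) ^ 3 *
        (W'.l₀ * W'.Λ (v 0) - W'.c) / (√(W'.δ (v 0)) * (W'.Λ (v 0) ^ 2 - W'.c))) r'.domain :=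
      fun v hv => by rw [hr' hv]; beta_reduce; ring
    have hdom' : ∀ v ∈ r'.domain, (lo : ℝ) ≤ v 0 ∧ v 0 ≤ hi := fun v hv => hdom v (hsub hv)
    have hδ'' : ∀ v ∈ r'.domain, 0 < W'.δ (v 0) := fun v hv => by rw [hδ']; exact hδ v (hsub hv)
    rcases hcase with hl₂ | ⟨hl₀0, hl₂, hcneg⟩
    · exact InBaker.conic_terminal_signed_const₀ W' γ s hk' (hl₂'.trans hl₂) he' lo hi hR4' r'
        hdom' hδ'' hr''
    · exact InBaker.conic_terminal_signed_const₁ W' γ s hk' ha' hκ₀' (hl₀'.trans hl₀0)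
        (by rw [hl₂']; exact hl₂) (by rw [hc]; exact hcneg) he' lo hi r' hdom' hδ'' hr''

/-- **CONIC-WALL HEIGHT TERMINAL — all strata with `k ≠ 0` except the double-root radicand.**
Generic (`δe ≠ 0`, simple roots), linear (`δe = 0 ≠ δf`) and constant (`δe = δf = 0`) radicands,
both branches `ε = ±1`: the `h`-input of `InBaker.psection_height` for a conic wall inside a rational
hull on which `R₄ ≠ 0`.  (The stratum `k = 0` is `InBaker.conic_height_k0`; the double-root stratum
`δe ≠ 0`, `4δeδg = δf²` is not treated here.) [this node] -/
theorem InBaker.conic_height_all (W : ConicWall) (γ ε : ℚ) (hε : ε = 1 ∨ ε = -1) (hk : W.k ≠ 0)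
    (ha : W.a ≠ 0) (hκ : 0 < W.κ₀ ∧ 0 ≤ W.κ₁)
    (hh : W.δe ≠ 0 → W.δg - W.δf ^ 2 / (4 * W.δe) ≠ 0) (lo hi : ℚ)
    (hR4 : ∀ x : ℝ, (lo : ℝ) ≤ x → x ≤ hi → Polynomial.aeval x W.R4Y ≠ 0)
    (r : KZ.IntegralRep 1) (hdom : ∀ v ∈ r.domain, (lo : ℝ) ≤ v 0 ∧ v 0 ≤ hi)
    (hδ : ∀ v ∈ r.domain, 0 < W.δ (v 0))
    (hr : EqOn r.integrand (BallCube.pheight W.κ₀ W.κ₁ γ W.a W.c (W.Xb ε) (W.Xb' ε)) r.domain) :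
    InBaker (KZ.of r) := by
  have hκ' : 0 ≤ W.κ₀ ∧ 0 ≤ W.κ₁ := ⟨hκ.1.le, hκ.2⟩
  by_cases he : W.δe = 0
  · by_cases hf : W.δf = 0
    · exact InBaker.conic_height_const W γ ε hε hk ha hκ he hf lo hi hR4 r hdom hδ hr
    · exact InBaker.conic_height_lin W γ ε hε hk ha hκ' he hf lo hi hR4 r hdom hδ hr
  · exact InBaker.conic_height W γ ε hε hk ha hκ' he (hh he) lo hi hR4 r hdom hδ hr

end Summit.KontsevichZagierPeriods.RootDecompWalshStrata.ConicDescent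

end
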